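import Summits.ValiantsHypothesis.ValiantsHypothesis.Theorems.KPlusLogSqLawTropicalBMasterLawSigned
import Summits.ValiantsHypothesis.ValiantsHypothesis.Theorems.KPlusLogSqLawTropicalBSignsFree

/-!
# Route `KPlusLogSqLaw`, crux `TropicalB` (stmt-ValiantsHypothesis-19771) — CONVERSE OF THE MASTER LAW, part 3:
# `TropicalB` WITHOUT VALUATIONS OR SLOPES (kernel iff)

HONEST FRAMING.  Helper file (seat val-sym-trop-p1 g26, cell `pub-symmetroid`, 2026-08-29; `--supports stmt-ValiantsHypothesis-19771
--as helper`) toward the registered stubs `stub_tropThin` / `stub_tropFat` of `Cruxes/TropicalB/Lines/birth.lean` (crux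
`Summit.ValiantsHypothesis.ValiantsHypothesis.Theses.KPlusLogSqLaw.TropicalB`, route `KPlusLogSqLaw`).  The one file of the three
(`…MasterLawConverse`, `…MasterLawComplete`, `…MasterLawSigned`, this) that imports the route: it composes the route-independent
realisability criteria (`MasterLaw.tropRowD_iff_certificateFree`, `MasterLaw.tropRootLawAt_iff_signedCertificateFree`) with
`tropicalB_iff_unsigned` (…TropicalBSignsFree), resp. with the definition of the crux (δ-equal to `∃ C, ∀ m K, TropRootLawAt m K _`).  An equivalence; it bounds nothing:
`TropicalB` / both stubs stay OPEN, the residual of record («long carries», g25) is untouched; nothing on `WeakLifting`, the cell's census /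
DoorA26 / DoorA34, `MatrixDescartes` (stmt-ValiantsHypothesis-18050) or VP ≠ VNP.

THE STATEMENTS.  `tropicalB_iff_signedCertificateFree` (EXACT form, same constant): `TropicalB` ⟺ there is `C` such that for all
`m, K, d`, every term sequence `p 0, …, p n` of format `(m, K)` that admits an alternating `±1` sign table and NO CERTIFICATE has
`n ≤ 2^(C (K + ⌊log₂ m⌋²))`.  `tropicalB_iff_certificateFree` (unsigned form, `C ↦ C + 1` inside): `TropicalB` ⟺ there is an absolute `C` such that for all `m, K`, every exponent vector
`d : Fin K → ℕ` and every sequence of terms `p 0, …, p n` of format `(m, K)` with consecutive terms distinct that admits NO CERTIFICATE —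
no non-negative rational multiplier system `lam k q` on pairs (position `k ≤ n`, competitor `q ≠ p k` all of whose incidences are
incidences of chain terms), not identically zero, that is incidence-balanced (`Σ lam · (ev F (p k) − ev F q) = 0` for every weight table
`F`) with every proper prefix of slope excesses `Σ_{k' ≤ k} Σ_q lam k' q (S (p k') − S q)` non-negative — satisfies
`n ≤ 2^(C (K + ⌊log₂ m⌋²))`.  The design, its valuations, its sign pattern and the integer sampling slopes are eliminated from the crux; what
remains is the exponent vector (through `S q = Σ_b d (q.2 b)`) and the finite combinatorics of weighted repackagings of incidences.
[this cell; LP duality is folklore]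
-/

set_option linter.dupNamespace false
set_option autoImplicit false

namespace Summit.ValiantsHypothesis.ValiantsHypothesis.Theorems.KPlusLogSqLaw.MasterLaw

open Summit.ValiantsHypothesis.ValiantsHypothesis.Theorems.MatrixDescartes.Negative
open Summit.ValiantsHypothesis.ValiantsHypothesis.Theorems.KPlusLogSqLaw.ConvexPosition
open Summit.ValiantsHypothesis.ValiantsHypothesis.Theorems.LacunarySymmetroidMatrixDescartes.TropicalCensus (slope TropRootLawAt)
open scoped BigOperators
open Finset

/-- **`TropicalB` WITHOUT VALUATIONS OR SLOPES (kernel iff).**  The crux `TropicalB` is equivalent to: there is an absolute `C` such that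
for all `m, K`, every exponent vector `d : Fin K → ℕ` and every sequence of terms `p 0, …, p n` of format `(m, K)` with consecutive terms
distinct that admits no certificate — no non-zero, non-negative rational multiplier system on pairs (chain position, chain-supported
competitor) which is incidence-balanced with non-negative proper prefix slope excesses — satisfies `n ≤ 2^(C (K + ⌊log₂ m⌋²))`.
The design, its valuations and the integer sampling slopes have been eliminated: what remains is the exponent vector (through the
slopes `S`) and the combinatorics of weighted repackagings of incidences.  Composition of `tropicalB_iff_unsigned` (…TropicalBSignsFree)
with `tropRowD_iff_certificateFree`.  Nothing here bounds anything; `TropicalB` stays OPEN. [this cell] -/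
theorem tropicalB_iff_certificateFree :
    Summit.ValiantsHypothesis.ValiantsHypothesis.Theses.KPlusLogSqLaw.TropicalB ↔
    ∃ C : ℕ, ∀ (m K : ℕ) (d : Fin K → ℕ) (n : ℕ) (p : ℕ → Equiv.Perm (Fin m) × (Fin m → Fin K)),
      (∀ k < n, p k ≠ p (k + 1)) →
      (∀ lam : ℕ → (Equiv.Perm (Fin m) × (Fin m → Fin K)) → ℚ, (∀ k q, 0 ≤ lam k q) →
        (∀ k q, lam k q ≠ 0 → k ≤ n ∧ q ≠ p k ∧ ∀ b, ∃ k' ≤ n, (p k').1 b = q.1 b ∧ (p k').2 b = q.2 b) →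
        (∀ F : Fin m × Fin m × Fin K → ℤ, ∑ k ∈ range (n + 1), ∑ q, lam k q * ((ev F (p k) : ℚ) - (ev F q : ℚ)) = 0) →
        (∀ k < n, 0 ≤ ∑ k' ∈ range (k + 1), ∑ q, lam k' q * ((slope d (p k') : ℚ) - (slope d q : ℚ))) →
        ∀ k q, lam k q = 0) →
      n ≤ 2 ^ (C * (K + Nat.log 2 m ^ 2)) := by
  rw [tropicalB_iff_unsigned]
  refine exists_congr fun C => forall_congr' fun m => ?_
  constructor
  · intro h K
    exact (tropRowD_iff_certificateFree m K _).mp (h K)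
  · intro h K
    exact (tropRowD_iff_certificateFree m K _).mpr (h K)


/-- **`TropicalB` WITHOUT VALUATIONS OR SLOPES — EXACT SIGNED FORM (kernel iff, same constant).**  The crux is equivalent to: there is an
absolute `C` such that for all `m, K`, every exponent vector `d` and every sequence of terms `p 0, …, p n` of format `(m, K)` which
(a) admits a `±1`-valued sign table on the cells making the formal signs `termSign s (p k)` alternate, and (b) carries no certificate,
satisfies `n ≤ 2^(C (K + ⌊log₂ m⌋²))`.  The definition of the crux unfolds to `∃ C, ∀ m K, TropRootLawAt m K _` (δ), and
`tropRootLawAt_iff_signedCertificateFree` does the rest.  Nothing is bounded; `TropicalB` stays OPEN. [this cell] -/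
theorem tropicalB_iff_signedCertificateFree :
    Summit.ValiantsHypothesis.ValiantsHypothesis.Theses.KPlusLogSqLaw.TropicalB ↔
    ∃ C : ℕ, ∀ (m K : ℕ) (d : Fin K → ℕ) (n : ℕ) (p : ℕ → Equiv.Perm (Fin m) × (Fin m → Fin K)),
      (∃ s : Fin m → Fin m → Fin K → ℤ, (∀ a b l, s a b l = 1 ∨ s a b l = -1) ∧
        ∀ k < n, termSign s (p k) * termSign s (p (k + 1)) < 0) →
      (∀ lam : ℕ → (Equiv.Perm (Fin m) × (Fin m → Fin K)) → ℚ, (∀ k q, 0 ≤ lam k q) →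
        (∀ k q, lam k q ≠ 0 → k ≤ n ∧ q ≠ p k ∧ ∀ b, ∃ k' ≤ n, (p k').1 b = q.1 b ∧ (p k').2 b = q.2 b) →
        (∀ F : Fin m × Fin m × Fin K → ℤ, ∑ k ∈ range (n + 1), ∑ q, lam k q * ((ev F (p k) : ℚ) - (ev F q : ℚ)) = 0) →
        (∀ k < n, 0 ≤ ∑ k' ∈ range (k + 1), ∑ q, lam k' q * ((slope d (p k') : ℚ) - (slope d q : ℚ))) →
        ∀ k q, lam k q = 0) →
      n ≤ 2 ^ (C * (K + Nat.log 2 m ^ 2)) := by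
  show (∃ C : ℕ, ∀ m K : ℕ, TropRootLawAt m K (2 ^ (C * (K + Nat.log 2 m ^ 2)))) ↔ _
  refine exists_congr fun C => forall_congr' fun m => forall_congr' fun K => ?_
  exact tropRootLawAt_iff_signedCertificateFree m K _

end Summit.ValiantsHypothesis.ValiantsHypothesis.Theorems.KPlusLogSqLaw.MasterLaw
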